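import Literature.NumberTheory.Sieve.ParityBatemanHorn
import Literature.NumberTheory.Sieve.LinearEquationsInPrimes
import HarnessLib

/-!
# Parity / GeneralizedHardyLittlewood — sub-problem statement (D-0017)

Moved out of `Summits/Parity/Statement.lean` with the declaration text unchanged.
-/

/-- Conjunct `GeneralizedHardyLittlewood` of `Parity`: the Literature statement
`Literature.NumberTheory.Sieve.GeneralizedHardyLittlewood` (Green–Tao 2010, Conjecture 1.2, all complexities), imported not
restated. [cite: GreenTao2010, Conj. 1.2] [problem: parity] -/
abbrev GeneralizedHardyLittlewood : Prop := Literature.NumberTheory.Sieve.GeneralizedHardyLittlewood
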